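import Summits.AtomisticToContinuum.Crystallization.Theorems.ChargedEnergyGapFeetLawA
import Summits.AtomisticToContinuum.Crystallization.Theorems.ChargedEnergyGapMemberValues
import HarnessLib

/-!
# ChargedEnergyGap · NODE 94 «PhiEnvelope» — the depth profile `φ = depthProfile ϱ` is monotone with range `[0, 1]`, and affine envelopes of a monotone
function are certified by FINITELY MANY POINT EVALUATIONS along a grid

decomp-a2c lens-3 g90 (L3 kernel of the Lean certificate path, memo CELLLP-SPEC-g90 §7 / critic row 1606 (A-c) «envelopes»; imports tree-only: …FeetLawA (the
profile) + …MemberValues (`smoothStep_mono`)).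

The cell LP of the (D¹) census (CELLCERT-SCHEMA §4, provenance «env») replaces the non-linear weight `W_v = φ(d_v)` on a depth window `d_v ∈ [lo, hi]` by
two affine envelope rows `s·d_v + c − δ⁻ ≤ W_v ≤ s'·d_v + c' + δ⁺`.  This node certifies such rows WITHOUT CALCULUS ON `φ`: since `φ` is MONOTONE (§94.1,
from the tree's `smoothStep_mono`), an affine minorant/majorant claim on `[lo, hi]` follows from its validity at the points of any grid `lo = a₀ ≤ a₁ ≤ … ≤ a_m = hi`
with the monotonicity slack absorbed pairwise (§94.2 `EnvBelow` / `EnvAbove`, recursive `Prop`s over the grid list, and their soundness theorems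
`envBelow_sound` / `envAbove_sound` for ANY monotone `f`).  Each grid condition is a comparison of `φ(aⱼ)` — an exact rational for rational `aⱼ`, evaluated by
`norm_num [depthProfile, smoothStep]` — with an affine expression: the census checker's «env» rows become `simp only [EnvBelow]; norm_num […]` obligations (§94.3,
probes in the audit file).  The finer the grid, the smaller the admissible `δ`; the certificate chooses the grid.

[SUPPORT node: inequalities and two bookkeeping predicates, all PROVED, 0 sorry; no cone statement touched; consumers: the per-slab certificate files (L5).] -/

noncomputable section
open scoped Classical
open Literature.MathematicalPhysics.StatisticalMechanics Literature.Geometry.DiscreteGeometry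
open Summit.AtomisticToContinuum.Crystallization.Theses.PricedLinkCensus
open Summit.AtomisticToContinuum.Crystallization.Theorems.ChargedEnergyGapNegative

namespace Summit.AtomisticToContinuum.Crystallization.Theorems.ChargedEnergyGapChartDial

/-! ## §94.1 The depth profile: monotone, with values in `[0, 1]`, `0` below `ϱ/2`, `1` above `ϱ` -/
section Profile

/-- ★ `φ ≤ 1`. -/
theorem depthProfile_le_one (ϱ t : ℝ) : depthProfile ϱ t ≤ 1 := by
  unfold depthProfile
  exact pow_le_one₀ (sub_nonneg.2 (smoothStep_le_one _)) (sub_le_self _ (smoothStep_nonneg _))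

/-- ★★ **`φ` is monotone (PROVED)**: deeper points carry larger weight (`0 < ϱ`). -/
theorem depthProfile_monotone {ϱ : ℝ} (hϱ : 0 < ϱ) : Monotone (depthProfile ϱ) := by
  intro t₁ t₂ h
  unfold depthProfile
  have harg : 2 - 2 * t₂ / ϱ ≤ 2 - 2 * t₁ / ϱ := by
    have := div_le_div_of_nonneg_right (mul_le_mul_of_nonneg_left h zero_le_two) hϱ.le
    linarith
  have hs := smoothStep_mono harg
  exact pow_le_pow_left₀ (sub_nonneg.2 (smoothStep_le_one _)) (by linarith) 4

/-- ★ `φ(t) = 0` for `t ≤ ϱ/2` (the smooth step has saturated). -/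
theorem depthProfile_of_le_half {ϱ t : ℝ} (hϱ : 0 < ϱ) (ht : t ≤ ϱ / 2) : depthProfile ϱ t = 0 := by
  unfold depthProfile
  have h1 : 1 ≤ 2 - 2 * t / ϱ := by
    have : 2 * t / ϱ ≤ 1 := by rw [div_le_one hϱ]; linarith
    linarith
  rw [smoothStep_of_one_le h1]
  norm_num

/-- ★ `φ(t) = 1` for `ϱ ≤ t` (bulk plateau). -/
theorem depthProfile_of_le {ϱ t : ℝ} (hϱ : 0 < ϱ) (ht : ϱ ≤ t) : depthProfile ϱ t = 1 := by
  unfold depthProfile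
  have h0 : 2 - 2 * t / ϱ ≤ 0 := by
    have : 2 ≤ 2 * t / ϱ := by rw [le_div_iff₀ hϱ]; linarith
    linarith
  rw [smoothStep_of_le_zero h0]
  norm_num

end Profile

/-! ## §94.2 Affine envelopes of a monotone function from grid evaluations -/
section Envelope

/-- [formal bookkeeping] an affine function on `[a, b]` is bounded by its endpoint values. -/
theorem affine_le_max_endpoints (s c a b d : ℝ) (ha : a ≤ d) (hb : d ≤ b) : s * d + c ≤ max (s * a + c) (s * b + c) := by
  rcases le_total 0 s with hs | hs
  · exact le_max_of_le_right (by nlinarith)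
  · exact le_max_of_le_left (by nlinarith)

/-- [formal bookkeeping] -/
theorem min_endpoints_le_affine (s c a b d : ℝ) (ha : a ≤ d) (hb : d ≤ b) : min (s * a + c) (s * b + c) ≤ s * d + c := by
  rcases le_total 0 s with hs | hs
  · exact min_le_of_left_le (by nlinarith)
  · exact min_le_of_right_le (by nlinarith)

/-- ★★ **GRID CHECK for an affine MINORANT** `s·d + c − δ ≤ f d` of a monotone `f` along the grid `a₀ :: a₁ :: … :: a_m`: consecutive points are ordered and
`max (ℓ a_j) (ℓ a_{j+1}) − δ ≤ f a_j` (`ℓ d = s·d + c`); a one-point grid checks the point itself.  Decidable by `norm_num` for rational data and `f = φ`. -/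
def EnvBelow (f : ℝ → ℝ) (s c δ : ℝ) : List ℝ → Prop
  | [] => True
  | [a] => s * a + c - δ ≤ f a
  | a :: b :: l => (a ≤ b ∧ max (s * a + c) (s * b + c) - δ ≤ f a) ∧ EnvBelow f s c δ (b :: l)

/-- ★★ **GRID CHECK for an affine MAJORANT** `f d ≤ s·d + c + δ`: consecutive points ordered and `f a_{j+1} ≤ min (ℓ a_j) (ℓ a_{j+1}) + δ`. -/
def EnvAbove (f : ℝ → ℝ) (s c δ : ℝ) : List ℝ → Prop
  | [] => True
  | [a] => f a ≤ s * a + c + δ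
  | a :: b :: l => (a ≤ b ∧ f b ≤ min (s * a + c) (s * b + c) + δ) ∧ EnvAbove f s c δ (b :: l)

/-- ★★★ **SOUNDNESS of the minorant grid check (PROVED)**: for monotone `f`, `EnvBelow f s c δ (a :: l)` gives `s·d + c − δ ≤ f d` on `[a, last (a :: l)]`. -/
theorem envBelow_sound {f : ℝ → ℝ} (hf : Monotone f) {s c δ : ℝ} :
    ∀ (l : List ℝ) (a : ℝ), EnvBelow f s c δ (a :: l) → ∀ d, a ≤ d → d ≤ (a :: l).getLast (List.cons_ne_nil a l) → s * d + c - δ ≤ f d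
  | [], a, h, d, had, hdl => by
      simp only [List.getLast_singleton] at hdl
      have hda : d = a := le_antisymm hdl had
      subst hda
      simpa [EnvBelow] using h
  | b :: l, a, h, d, had, hdl => by
      simp only [EnvBelow] at h
      obtain ⟨⟨-, hfa⟩, hrest⟩ := h
      rcases le_total d b with hdb | hbd
      · calc s * d + c - δ ≤ max (s * a + c) (s * b + c) - δ := by linarith [affine_le_max_endpoints s c a b d had hdb]
          _ ≤ f a := hfa
          _ ≤ f d := hf had
      · rw [List.getLast_cons_cons] at hdl
        exact envBelow_sound hf l b hrest d hbd hdl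

/-- ★★★ **SOUNDNESS of the majorant grid check (PROVED)**. -/
theorem envAbove_sound {f : ℝ → ℝ} (hf : Monotone f) {s c δ : ℝ} :
    ∀ (l : List ℝ) (a : ℝ), EnvAbove f s c δ (a :: l) → ∀ d, a ≤ d → d ≤ (a :: l).getLast (List.cons_ne_nil a l) → f d ≤ s * d + c + δ
  | [], a, h, d, had, hdl => by
      simp only [List.getLast_singleton] at hdl
      have hda : d = a := le_antisymm hdl had
      subst hda
      simpa [EnvAbove] using h
  | b :: l, a, h, d, had, hdl => by
      simp only [EnvAbove] at h
      obtain ⟨⟨-, hfb⟩, hrest⟩ := h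
      rcases le_total d b with hdb | hbd
      · calc f d ≤ f b := hf hdb
          _ ≤ min (s * a + c) (s * b + c) + δ := hfb
          _ ≤ s * d + c + δ := by linarith [min_endpoints_le_affine s c a b d had hdb]
      · rw [List.getLast_cons_cons] at hdl
        exact envAbove_sound hf l b hrest d hbd hdl

/-- ★ Minorant on a named window `[lo, hi]` (`hi` = the last grid point, supplied by `rfl`/`simp` in certificate files). -/
theorem envBelow_window {f : ℝ → ℝ} (hf : Monotone f) {s c δ : ℝ} (l : List ℝ) (lo hi : ℝ)
    (hhi : (lo :: l).getLast (List.cons_ne_nil lo l) = hi) (h : EnvBelow f s c δ (lo :: l)) :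
    ∀ d, lo ≤ d → d ≤ hi → s * d + c - δ ≤ f d := fun d h₁ h₂ =>
  envBelow_sound hf l lo h d h₁ (hhi ▸ h₂)

/-- ★ Majorant on a named window `[lo, hi]`. -/
theorem envAbove_window {f : ℝ → ℝ} (hf : Monotone f) {s c δ : ℝ} (l : List ℝ) (lo hi : ℝ)
    (hhi : (lo :: l).getLast (List.cons_ne_nil lo l) = hi) (h : EnvAbove f s c δ (lo :: l)) :
    ∀ d, lo ≤ d → d ≤ hi → f d ≤ s * d + c + δ := fun d h₁ h₂ =>
  envAbove_sound hf l lo h d h₁ (hhi ▸ h₂)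

end Envelope

/-! ## §94.3 The «env» rows of the census: affine envelopes of `φ` on a depth window -/
section PhiRows

/-- ★★ **LOWER «env» ROW (PROVED)**: a grid certificate gives `s·d + c − δ ≤ φ(d)` for `d ∈ [lo, hi]`. -/
theorem depthProfile_envBelow {ϱ : ℝ} (hϱ : 0 < ϱ) {s c δ : ℝ} (l : List ℝ) (lo hi : ℝ)
    (hhi : (lo :: l).getLast (List.cons_ne_nil lo l) = hi) (h : EnvBelow (depthProfile ϱ) s c δ (lo :: l)) :
    ∀ d, lo ≤ d → d ≤ hi → s * d + c - δ ≤ depthProfile ϱ d :=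
  envBelow_window (depthProfile_monotone hϱ) l lo hi hhi h

/-- ★★ **UPPER «env» ROW (PROVED)**: a grid certificate gives `φ(d) ≤ s·d + c + δ` for `d ∈ [lo, hi]`. -/
theorem depthProfile_envAbove {ϱ : ℝ} (hϱ : 0 < ϱ) {s c δ : ℝ} (l : List ℝ) (lo hi : ℝ)
    (hhi : (lo :: l).getLast (List.cons_ne_nil lo l) = hi) (h : EnvAbove (depthProfile ϱ) s c δ (lo :: l)) :
    ∀ d, lo ≤ d → d ≤ hi → depthProfile ϱ d ≤ s * d + c + δ :=
  envAbove_window (depthProfile_monotone hϱ) l lo hi hhi h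

/-- ★ The trivial box row: on `[lo, hi]`, `φ(lo) ≤ φ(d) ≤ φ(hi)` (the interval-arithmetic fallback of the census, provenance «env» with `s = 0`). -/
theorem depthProfile_mem_Icc {ϱ : ℝ} (hϱ : 0 < ϱ) {lo hi d : ℝ} (h₁ : lo ≤ d) (h₂ : d ≤ hi) :
    depthProfile ϱ lo ≤ depthProfile ϱ d ∧ depthProfile ϱ d ≤ depthProfile ϱ hi :=
  ⟨depthProfile_monotone hϱ h₁, depthProfile_monotone hϱ h₂⟩

end PhiRows

end Summit.AtomisticToContinuum.Crystallization.Theorems.ChargedEnergyGapChartDial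

end
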